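import Summits.AtomisticToContinuum.HydrodynamicLimit.Theorems.JaynesSqueezeBlockGibbsToRelEntropyEntropyConservation
import Summits.AtomisticToContinuum.HydrodynamicLimit.Theorems.BoxDissipativeWeakStrongEntropyAdmissibilityStubTestTransportIdentity

/-!
# Crux `EntropyAdmissibility` (stmt-AtomisticToContinuum-9903), line `registered` — stub `stub_smoothRenormalizedEntropyConservation` (FS2a)

FS2a of the lead's skeleton: the weak form, tested against an arbitrary test function `φ` jointly
smooth on `[0, T) × 𝕋³`, of the **renormalised entropy conservation** of a classical hard-sphere
Euler solution `(ρ, u, θ)` staying in the analytic band `ρσ³ < η₀` of the excess free energy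
`f_ex = hsExcessFreeEnergy`: with `s = 3/2 log θ − log ρ − f_ex(ρσ³)` (entropy per particle) and any
`C^∞` function `Z : ℝ → ℝ`,
`∫_{(0,τ]} ∫_{𝕋³} (ρ Z(s) ∂ₜφ + Z(s) ⟪ρu, ∇φ⟫) − ∫ ρ Z(s) φ |_{t=τ} + ∫ ρ Z(s) φ |_{t=0} = 0`
for `τ ∈ [0, T)` (smooth flows are isentropic along particle paths, hence so is every `Z(s)`).

Proof (deterministic calculus on `[0, T) × 𝕋³`, no particles).
* `transport_mul`: for jointly smooth scalar fields `a, b` and velocity `u`,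
  `∂ₜ(ab) + div(ab u) = b (∂ₜa + div(a u)) + a (∂ₜb + u·∇b)` (Leibniz rules for
  `Torus.timeDerivWithin`, `Torus.partialDeriv`, `Torus.divergence`).
* With `a = ρ`, `b = s`: mass conservation (`IsHardSphereEulerSolution.mass`) and the pointwise
  entropy balance `∂ₜ(ρs) + div(ρsu) = 0` (`JaynesSqueezeClosure.entropy_balance`) give `ρ Dₜs = 0`,
  so `Dₜs := ∂ₜs + u·∇s = 0` (`ρ > 0`); the chain rule gives `Dₜ Z(s) = Z'(s) Dₜs = 0`, and
  `transport_mul` with `b = Z(s)` gives the pointwise renormalised balance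
  `∂ₜ(ρZ(s)) + div(ρZ(s)u) = 0` (`renormalized_entropy_balance`).
* Test against `φ`: `E(t) = ∫ ρZ(s)φ dx` has one-sided derivative `∫ ∂ₜ(ρZ(s)φ)` within `[0, T)`
  (`Torus.IsSmoothSpaceTimeOn.hasDerivWithinAt_integral`), and
  `∫ ∂ₜ(ρZ(s)φ) = ∫ (ρZ(s)∂ₜφ − φ div(ρZ(s)u)) = ∫ (ρZ(s)∂ₜφ + ⟪ρZ(s)u, ∇φ⟫)` (integration by parts
  on `𝕋³`, `Torus.integral_inner_gradient_eq_neg_integral_mul_divergence_holds`).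
* The fundamental theorem of calculus on `[0, τ]` (`intervalIntegral.integral_eq_sub_of_hasDeriv_right_of_le`,
  the derivative being continuous as the space integral of a jointly smooth field,
  `Torus.IsSmoothSpaceTimeOn.continuousOn_integral`).
References: C. M. Dafermos, *Hyperbolic Conservation Laws in Continuum Physics* (2005), §3.3.6;
J. Březina, E. Feireisl, J. Math. Soc. Japan 70 (2018), Def. 2.9; L. C. Evans, *Partial Differential
Equations* (2010), App. C.2.
-/

noncomputable section

open MeasureTheory Filter Set
open scoped Topology ContDiff InnerProductSpace

namespace Summit.AtomisticToContinuum.HydrodynamicLimit.Theorems.EABirthFS2a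

open Literature.MathematicalPhysics.KineticTheory
open Literature.Analysis.FunctionSpaces Literature.Analysis.FunctionSpaces.Torus
open Literature.Analysis.FluidPDE.CompressibleEuler (timeDerivWithin_mul)
open Summit.AtomisticToContinuum.HydrodynamicLimit.Theorems.JaynesSqueezeClosure
  (entropy_balance isSmoothSpaceTimeOn_comp_of_mem)

/-! ## Pointwise calculus on `S × 𝕋³` -/

section Calculus

variable {S : Set ℝ} {t : ℝ}

/-- Transport of a product: for jointly smooth scalar fields `a, b` and a jointly smooth velocity
field `u` on `S × 𝕋³`, `∂ₜ(ab) + div(ab u) = b (∂ₜa + div(a u)) + a (∂ₜb + ∑ᵢ uᵢ ∂ᵢb)` pointwise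
(Leibniz rules). -/
theorem transport_mul {a b : ℝ → T3 → ℝ} {u : ℝ → T3 → V3} (ha : IsSmoothSpaceTimeOn S a)
    (hb : IsSmoothSpaceTimeOn S b) (hu : IsSmoothSpaceTimeOn S u) (hS : UniqueDiffOn ℝ S)
    (ht : t ∈ S) (x : T3) :
    timeDerivWithin S (fun s y => a s y * b s y) t x +
        divergence (fun y => (a t y * b t y) • u t y) x =
      b t x * (timeDerivWithin S a t x + divergence (fun y => a t y • u t y) x) +
        a t x * (timeDerivWithin S b t x + ∑ i, u t x i * partialDeriv i (b t) x) := by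
  have ha1 : IsContDiff 1 (a t) := (ha.isSmooth_slice ht).isContDiff (by simp)
  have hb1 : IsContDiff 1 (b t) := (hb.isSmooth_slice ht).isContDiff (by simp)
  have hu1 : IsContDiff 1 (u t) := (hu.isSmooth_slice ht).isContDiff (by simp)
  have hab1 : IsContDiff 1 (fun y => a t y * b t y) :=
    ((ha.mul hb).isSmooth_slice ht).isContDiff (by simp)
  rw [timeDerivWithin_mul ha hb hS ht x, divergence_smul hab1 hu1 x, divergence_smul ha1 hu1 x]
  simp_rw [partialDeriv_mul ha1 hb1]
  have hsum : ∑ i, u t x i * (a t x * partialDeriv i (b t) x + partialDeriv i (a t) x * b t x) =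
      a t x * ∑ i, u t x i * partialDeriv i (b t) x + b t x * ∑ i, u t x i * partialDeriv i (a t) x := by
    rw [Finset.mul_sum, Finset.mul_sum, ← Finset.sum_add_distrib]
    exact Finset.sum_congr rfl fun i _ => by ring
  rw [hsum]
  ring

/-- Chain rule for the one-sided time derivative of `Z ∘ f`, `Z : ℝ → ℝ` smooth, `f` a jointly
smooth scalar field: `∂ₜ Z(f) = Z'(f) ∂ₜf`. -/
theorem timeDerivWithin_comp_scalar {Z : ℝ → ℝ} (hZ : ContDiff ℝ ∞ Z) {f : ℝ → T3 → ℝ}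
    (hf : IsSmoothSpaceTimeOn S f) (hS : UniqueDiffOn ℝ S) (ht : t ∈ S) (x : T3) :
    timeDerivWithin S (fun s y => Z (f s y)) t x = deriv Z (f t x) * timeDerivWithin S f t x := by
  have hZd : HasDerivAt Z (deriv Z (f t x)) (f t x) :=
    ((hZ.differentiable (by simp)).differentiableAt).hasDerivAt
  exact (hZd.comp_hasDerivWithinAt t (hf.hasDerivWithinAt_slice ht x)).derivWithin (hS t ht)

/-- Chain rule for partial derivatives of `Z ∘ f` on the torus, `Z : ℝ → ℝ` smooth, `f` a `C¹`
scalar function: `∂ᵢ Z(f) = Z'(f) ∂ᵢf`. -/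
theorem partialDeriv_comp_scalar {Z : ℝ → ℝ} (hZ : ContDiff ℝ ∞ Z) {f : T3 → ℝ}
    (hf : IsContDiff 1 f) (i : Fin 3) (x : T3) :
    partialDeriv i (fun y => Z (f y)) x = deriv Z (f x) * partialDeriv i f x := by
  have hg : ContDiffOn ℝ ∞ (Function.uncurry fun a _ : ℝ => Z a) univ :=
    (hZ.comp contDiff_fst).contDiffOn
  have h := partialDeriv_comp₂ hg isOpen_univ (by simp) hf hf x (mem_univ _) i
  simpa using h

end Calculus

/-! ## The pointwise renormalised entropy balance -/

variable {σ η₀ T : ℝ} {ρ θ : ℝ → T3 → ℝ} {u : ℝ → T3 → V3}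

/-- The entropy per particle `s(a, b) = 3/2 log b − log a − f_ex(aσ³)` is smooth on the band
`{0 < aσ³ < η₀} × {b > 0}` when `f_ex` is smooth on `(0, η₀)`. -/
theorem contDiffOn_entropyPerParticle_band (hf : ContDiffOn ℝ ∞ hsExcessFreeEnergy (Ioo 0 η₀)) :
    ContDiffOn ℝ ∞ (Function.uncurry fun a b : ℝ =>
        3 / 2 * Real.log b - Real.log a - hsExcessFreeEnergy (a * σ ^ 3))
      {q : ℝ × ℝ | q.1 * σ ^ 3 ∈ Ioo 0 η₀ ∧ 0 < q.2} := by
  have hη : ContDiffOn ℝ ∞ (fun q : ℝ × ℝ => q.1 * σ ^ 3) {q : ℝ × ℝ | q.1 * σ ^ 3 ∈ Ioo 0 η₀ ∧ 0 < q.2} :=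
    contDiffOn_fst.mul contDiffOn_const
  have hmaps : MapsTo (fun q : ℝ × ℝ => q.1 * σ ^ 3) {q : ℝ × ℝ | q.1 * σ ^ 3 ∈ Ioo 0 η₀ ∧ 0 < q.2}
      (Ioo 0 η₀) := fun q hq => hq.1
  have h1 : ∀ q ∈ {q : ℝ × ℝ | q.1 * σ ^ 3 ∈ Ioo 0 η₀ ∧ 0 < q.2}, q.1 ≠ 0 := by
    intro q hq h0
    have := hq.1.1
    rw [h0, zero_mul] at this
    exact lt_irrefl _ this
  have h2 : ∀ q ∈ {q : ℝ × ℝ | q.1 * σ ^ 3 ∈ Ioo 0 η₀ ∧ 0 < q.2}, q.2 ≠ 0 := fun q hq => hq.2.ne'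
  have h : (Function.uncurry fun a b : ℝ => 3 / 2 * Real.log b - Real.log a - hsExcessFreeEnergy (a * σ ^ 3)) =
      fun q : ℝ × ℝ => 3 / 2 * Real.log q.2 - Real.log q.1 - hsExcessFreeEnergy (q.1 * σ ^ 3) := by
    funext q; rfl
  rw [h]
  exact ((contDiffOn_const.mul (contDiffOn_snd.log h2)).sub (contDiffOn_fst.log h1)).sub
    (hf.comp hη hmaps)

/-- The entropy per particle `s = 3/2 log θ − log ρ − f_ex(ρσ³)` of a classical hard-sphere Euler
solution in the band is a jointly smooth field on `[0, T) × 𝕋³`. -/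
theorem isSmoothSpaceTimeOn_entropyPerParticle (hσ : 0 < σ)
    (hf : ContDiffOn ℝ ∞ hsExcessFreeEnergy (Ioo 0 η₀)) (hE : IsHardSphereEulerSolution σ T ρ u θ)
    (hband : ∀ t ∈ Ico 0 T, ∀ x, ρ t x * σ ^ 3 < η₀) :
    IsSmoothSpaceTimeOn (Ico 0 T)
      (fun s y => 3 / 2 * Real.log (θ s y) - Real.log (ρ s y) - hsExcessFreeEnergy (ρ s y * σ ^ 3)) :=
  isSmoothSpaceTimeOn_comp_of_mem
    (g := fun a b : ℝ => 3 / 2 * Real.log b - Real.log a - hsExcessFreeEnergy (a * σ ^ 3))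
    (contDiffOn_entropyPerParticle_band hf) hE.smooth_density hE.smooth_temperature
    fun s hs y => ⟨⟨mul_pos (hE.density_pos s hs y) (pow_pos hσ 3), hband s hs y⟩, hE.temperature_pos s hs y⟩

/-- **The pointwise renormalised entropy balance** of a classical hard-sphere Euler solution in the
band: for every smooth `Z : ℝ → ℝ`, `∂ₜ(ρ Z(s)) + div(ρ Z(s) u) = 0` on `[0, T) × 𝕋³`,
`s = 3/2 log θ − log ρ − f_ex(ρσ³)` (from `entropy_balance` and mass conservation: `Dₜs = 0`, hence
`DₜZ(s) = Z'(s) Dₜs = 0`). -/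
theorem renormalized_entropy_balance (hσ : 0 < σ) (hf : ContDiffOn ℝ ∞ hsExcessFreeEnergy (Ioo 0 η₀))
    (hE : IsHardSphereEulerSolution σ T ρ u θ) (hband : ∀ t ∈ Ico 0 T, ∀ x, ρ t x * σ ^ 3 < η₀)
    {Z : ℝ → ℝ} (hZ : ContDiff ℝ ∞ Z) {t : ℝ} (ht : t ∈ Ico 0 T) (x : T3) :
    timeDerivWithin (Ico 0 T)
        (fun s y => ρ s y * Z (3 / 2 * Real.log (θ s y) - Real.log (ρ s y) -
          hsExcessFreeEnergy (ρ s y * σ ^ 3))) t x +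
      divergence (fun y => (ρ t y * Z (3 / 2 * Real.log (θ t y) - Real.log (ρ t y) -
        hsExcessFreeEnergy (ρ t y * σ ^ 3))) • u t y) x = 0 := by
  have hS : UniqueDiffOn ℝ (Ico (0 : ℝ) T) := uniqueDiffOn_Ico 0 T
  have hρ := hE.smooth_density
  have hu := hE.smooth_velocity
  have hsF := isSmoothSpaceTimeOn_entropyPerParticle hσ hf hE hband
  have hZs : IsSmoothSpaceTimeOn (Ico 0 T)
      (fun s y => Z (3 / 2 * Real.log (θ s y) - Real.log (ρ s y) - hsExcessFreeEnergy (ρ s y * σ ^ 3))) :=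
    hZ.comp_contDiffOn hsF
  have hρ0 : ρ t x ≠ 0 := (hE.density_pos t ht x).ne'
  have hmass := hE.mass t ht x
  -- `ρ Dₜs = 0`
  have h1 := transport_mul hρ hsF hu hS ht x
  rw [entropy_balance hσ hf hE hband ht x, hmass, mul_zero, zero_add] at h1
  have hDs := (mul_eq_zero.1 h1.symm).resolve_left hρ0
  -- `∂ₜ(ρZ(s)) + div(ρZ(s)u) = ρ DₜZ(s) = ρ Z'(s) Dₜs = 0`
  have h2 := transport_mul hρ hZs hu hS ht x
  rw [hmass, mul_zero, zero_add] at h2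
  rw [h2, timeDerivWithin_comp_scalar hZ hsF hS ht x]
  simp_rw [partialDeriv_comp_scalar hZ ((hsF.isSmooth_slice ht).isContDiff (by simp))]
  have hsum : ∑ i, u t x i * (deriv Z (3 / 2 * Real.log (θ t x) - Real.log (ρ t x) -
      hsExcessFreeEnergy (ρ t x * σ ^ 3)) * partialDeriv i
        (fun y => 3 / 2 * Real.log (θ t y) - Real.log (ρ t y) - hsExcessFreeEnergy (ρ t y * σ ^ 3)) x) =
      deriv Z (3 / 2 * Real.log (θ t x) - Real.log (ρ t x) - hsExcessFreeEnergy (ρ t x * σ ^ 3)) *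
        ∑ i, u t x i * partialDeriv i
          (fun y => 3 / 2 * Real.log (θ t y) - Real.log (ρ t y) - hsExcessFreeEnergy (ρ t y * σ ^ 3)) x := by
    rw [Finset.mul_sum]
    exact Finset.sum_congr rfl fun i _ => by ring
  rw [hsum, ← mul_add, hDs, mul_zero, mul_zero]

/-! ## Testing against `φ`: integration by parts in space, fundamental theorem of calculus in time -/

/-- The space slice of the weak form: if `∂ₜH + div(H u) = 0` at time `t ∈ S`, then
`∫ ∂ₜ(H φ)(t) = ∫ (H ∂ₜφ + ⟪H u, ∇φ⟫)(t)` (Leibniz rule in time and integration by parts on `𝕋³`). -/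
theorem integral_timeDerivWithin_mul_test {S : Set ℝ} (hS : UniqueDiffOn ℝ S) {H φ : ℝ → T3 → ℝ}
    {u : ℝ → T3 → V3} (hH : IsSmoothSpaceTimeOn S H) (hφ : IsSmoothSpaceTimeOn S φ)
    (hu : IsSmoothSpaceTimeOn S u) {t : ℝ} (ht : t ∈ S)
    (hbal : ∀ x, timeDerivWithin S H t x + divergence (fun y => H t y • u t y) x = 0) :
    ∫ x, timeDerivWithin S (fun s y => H s y * φ s y) t x =
      ∫ x, (H t x * timeDerivWithin S φ t x + ⟪H t x • u t x, Torus.gradient (φ t) x⟫_ℝ) := by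
  have hV : IsSmooth (fun y => H t y • u t y) := (hH.smul hu).isSmooth_slice ht
  have hφt : IsSmooth (φ t) := hφ.isSmooth_slice ht
  have hpt : ∀ x, timeDerivWithin S (fun s y => H s y * φ s y) t x =
      H t x * timeDerivWithin S φ t x + -(φ t x * divergence (fun y => H t y • u t y) x) := by
    intro x
    rw [timeDerivWithin_mul hH hφ hS ht x]
    linear_combination (φ t x) * hbal x
  have i1 : Integrable (fun x => H t x * timeDerivWithin S φ t x) :=
    ((hH.mul (hφ.timeDerivWithin hS)).isSmooth_slice ht).integrable
  have i2 : Integrable (fun x => -(φ t x * divergence (fun y => H t y • u t y) x)) :=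
    ((hφ.mul ((hH.smul hu).divergence hS)).isSmooth_slice ht).integrable.neg
  have i3 : Integrable (fun x => ⟪H t x • u t x, Torus.gradient (φ t) x⟫_ℝ) :=
    (((hH.smul hu).inner (hφ.gradient hS)).isSmooth_slice ht).integrable
  simp_rw [hpt]
  rw [integral_add i1 i2, integral_neg, integral_add i1 i3,
    integral_inner_gradient_eq_neg_integral_mul_divergence_holds hV hφt]

/-- The fundamental theorem of calculus on `[0, τ] ⊆ [0, T)` for a function with a continuous
one-sided derivative within `[0, T)`: `∫_{(0,τ]} E' = E(τ) − E(0)`. -/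
theorem integral_Ioc_eq_sub_of_hasDerivWithinAt {T τ : ℝ} (hτ : τ ∈ Ico 0 T) {E E' : ℝ → ℝ}
    (hderiv : ∀ t ∈ Ico 0 T, HasDerivWithinAt E (E' t) (Ico 0 T) t)
    (hcont : ContinuousOn E' (Ico 0 T)) :
    ∫ t in Ioc 0 τ, E' t = E τ - E 0 := by
  have hEcont : ContinuousOn E (Icc 0 τ) := fun s hs =>
    ((hderiv s ⟨hs.1, hs.2.trans_lt hτ.2⟩).continuousWithinAt).mono (Icc_subset_Ico_right hτ.2)
  have hder : ∀ s ∈ Ioo 0 τ, HasDerivWithinAt E (E' s) (Ioi s) s := by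
    intro s hs
    have hsT : s ∈ Ico 0 T := ⟨hs.1.le, hs.2.trans hτ.2⟩
    exact ((hderiv s hsT).hasDerivAt (Ico_mem_nhds hs.1 hsT.2)).hasDerivWithinAt
  have hint : IntervalIntegrable E' volume 0 τ :=
    (hcont.mono (Icc_subset_Ico_right hτ.2)).intervalIntegrable_of_Icc hτ.1
  have hftc := intervalIntegral.integral_eq_sub_of_hasDeriv_right_of_le hτ.1 hEcont hder hint
  rwa [intervalIntegral.integral_of_le hτ.1] at hftc

/-! ## The stub -/

/-- Signature of FS2a (verbatim the skeleton's `Sig.stub_smoothRenormalizedEntropyConservation`). -/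
def Sig.stub_smoothRenormalizedEntropyConservation : Prop :=
  ∀ (σ η₀ : ℝ), 0 < σ → 0 < η₀ → ContDiffOn ℝ ∞ hsExcessFreeEnergy (Ioo 0 η₀) →
    ∀ (T : ℝ) (ρ θ : ℝ → T3 → ℝ) (u : ℝ → T3 → V3), IsHardSphereEulerSolution σ T ρ u θ →
      (∀ t ∈ Ico 0 T, ∀ x, ρ t x * σ ^ 3 < η₀) →
      ∀ Z : ℝ → ℝ, ContDiff ℝ ∞ Z →
      ∀ τ ∈ Ico 0 T, ∀ φ : ℝ → T3 → ℝ, Literature.Analysis.FunctionSpaces.Torus.IsSmoothSpaceTimeOn (Ico 0 T) φ →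
        (∫ t in Ioc 0 τ, ∫ x,
            (ρ t x * Z (3 / 2 * Real.log (θ t x) - Real.log (ρ t x) - hsExcessFreeEnergy (ρ t x * σ ^ 3)) *
                Literature.Analysis.FunctionSpaces.Torus.timeDerivWithin (Ico 0 T) φ t x +
              Z (3 / 2 * Real.log (θ t x) - Real.log (ρ t x) - hsExcessFreeEnergy (ρ t x * σ ^ 3)) *
                inner ℝ (ρ t x • u t x) (Literature.Analysis.FunctionSpaces.Torus.gradient (φ t) x))) -
          (∫ x, ρ τ x * Z (3 / 2 * Real.log (θ τ x) - Real.log (ρ τ x) - hsExcessFreeEnergy (ρ τ x * σ ^ 3)) * φ τ x) +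
          ∫ x, ρ 0 x * Z (3 / 2 * Real.log (θ 0 x) - Real.log (ρ 0 x) - hsExcessFreeEnergy (ρ 0 x * σ ^ 3)) * φ 0 x = 0

/-- **Stub FS2a** (crux stmt-AtomisticToContinuum-9903, line `registered`): the weak form of the
renormalised entropy conservation `∂ₜ(ρZ(s)) + div(ρZ(s)u) = 0` of a classical hard-sphere Euler
solution in the analytic band, tested against any `φ` jointly smooth on `[0, T) × 𝕋³`:
`∫_{(0,τ]}∫ (ρZ(s)∂ₜφ + Z(s)⟪ρu, ∇φ⟫) − ∫ ρZ(s)φ|_τ + ∫ ρZ(s)φ|_0 = 0`. -/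
theorem stub_smoothRenormalizedEntropyConservation : Sig.stub_smoothRenormalizedEntropyConservation := by
  intro σ η₀ hσ _hη₀ hf T ρ θ u hE hband Z hZ τ hτ φ hφ
  have hS : UniqueDiffOn ℝ (Ico (0 : ℝ) T) := uniqueDiffOn_Ico 0 T
  have hρ := hE.smooth_density
  have hu := hE.smooth_velocity
  have hsF := isSmoothSpaceTimeOn_entropyPerParticle hσ hf hE hband
  have hZs : IsSmoothSpaceTimeOn (Ico 0 T)
      (fun s y => Z (3 / 2 * Real.log (θ s y) - Real.log (ρ s y) - hsExcessFreeEnergy (ρ s y * σ ^ 3))) :=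
    hZ.comp_contDiffOn hsF
  have hH : IsSmoothSpaceTimeOn (Ico 0 T)
      (fun s y => ρ s y * Z (3 / 2 * Real.log (θ s y) - Real.log (ρ s y) - hsExcessFreeEnergy (ρ s y * σ ^ 3))) :=
    hρ.mul hZs
  -- the bulk integrand is jointly smooth, so its space integral is continuous in time
  have hF : IsSmoothSpaceTimeOn (Ico 0 T) (fun t x =>
      ρ t x * Z (3 / 2 * Real.log (θ t x) - Real.log (ρ t x) - hsExcessFreeEnergy (ρ t x * σ ^ 3)) *
          timeDerivWithin (Ico 0 T) φ t x +
        Z (3 / 2 * Real.log (θ t x) - Real.log (ρ t x) - hsExcessFreeEnergy (ρ t x * σ ^ 3)) *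
          ⟪ρ t x • u t x, Torus.gradient (φ t) x⟫_ℝ) :=
    (hH.mul (hφ.timeDerivWithin hS)).add (hZs.mul ((hρ.smul hu).inner (hφ.gradient hS)))
  have hcont := hF.continuousOn_integral (convex_Ico 0 T)
  -- `d/dt ∫ ρZ(s)φ = ∫ (ρZ(s)∂ₜφ + Z(s)⟪ρu, ∇φ⟫)` within `[0, T)`
  have hderiv : ∀ t ∈ Ico 0 T, HasDerivWithinAt
      (fun s => ∫ x, ρ s x * Z (3 / 2 * Real.log (θ s x) - Real.log (ρ s x) -
        hsExcessFreeEnergy (ρ s x * σ ^ 3)) * φ s x)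
      (∫ x, (ρ t x * Z (3 / 2 * Real.log (θ t x) - Real.log (ρ t x) - hsExcessFreeEnergy (ρ t x * σ ^ 3)) *
          timeDerivWithin (Ico 0 T) φ t x +
        Z (3 / 2 * Real.log (θ t x) - Real.log (ρ t x) - hsExcessFreeEnergy (ρ t x * σ ^ 3)) *
          ⟪ρ t x • u t x, Torus.gradient (φ t) x⟫_ℝ)) (Ico 0 T) t := by
    intro t ht
    have h1 := (hH.mul hφ).hasDerivWithinAt_integral (convex_Ico 0 T) ht
    have h2 := integral_timeDerivWithin_mul_test hS hH hφ hu ht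
      fun x => renormalized_entropy_balance hσ hf hE hband hZ ht x
    have h3 : ∫ x, (ρ t x * Z (3 / 2 * Real.log (θ t x) - Real.log (ρ t x) - hsExcessFreeEnergy (ρ t x * σ ^ 3)) *
          timeDerivWithin (Ico 0 T) φ t x +
        ⟪(ρ t x * Z (3 / 2 * Real.log (θ t x) - Real.log (ρ t x) - hsExcessFreeEnergy (ρ t x * σ ^ 3))) • u t x,
          Torus.gradient (φ t) x⟫_ℝ) =
        ∫ x, (ρ t x * Z (3 / 2 * Real.log (θ t x) - Real.log (ρ t x) - hsExcessFreeEnergy (ρ t x * σ ^ 3)) *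
          timeDerivWithin (Ico 0 T) φ t x +
        Z (3 / 2 * Real.log (θ t x) - Real.log (ρ t x) - hsExcessFreeEnergy (ρ t x * σ ^ 3)) *
          ⟪ρ t x • u t x, Torus.gradient (φ t) x⟫_ℝ) := by
      refine integral_congr_ae (Eventually.of_forall fun x => ?_)
      simp only [real_inner_smul_left]
      ring
    rw [h2, h3] at h1
    exact h1
  rw [integral_Ioc_eq_sub_of_hasDerivWithinAt hτ hderiv hcont]
  ring

end Summit.AtomisticToContinuum.HydrodynamicLimit.Theorems.EABirthFS2a

end
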